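import Literature.Analysis.FluidPDE.TaoAveragedAngleSynthesis
import Mathlib.Analysis.SpecialFunctions.Trigonometric.Bounds
import HarnessLib

/-!
# Crux `GappedShellCensus.ShellTrichotomy` (stmt-AtomisticToContinuum-18070), line `Sketch` —
# stub `stub_smallRot`

**Small rotations (Rodrigues remainder).**  For every `ω ∈ ℝ³` there is a linear isometry `S`
of `ℝ³` with `‖S X − X − ω × X‖ ≤ (‖ω‖²/2 + ‖ω‖³/4) ‖X‖` for all `X`: the infinitesimal rotation
`X ↦ X + ω × X` is, up to a second-order remainder, an exact isometry.

## Proof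

For `ω = 0` take `S = id`.  For `ω ≠ 0` take `S := R_ω^θ` (`rodRotEquiv`), the rotation by the
angle `θ = ‖ω‖` about the axis `ω`; with the unit axis `u = ω/‖ω‖` and `X⊥ = X − ⟪X,u⟫ u`,
Rodrigues' formula gives
`R_ω^θ X − X − ω × X = (cos θ − 1) X⊥ + (sin θ − θ) (u × X)` (as `ω × X = θ (u × X)`),
and `‖X⊥‖ ≤ ‖X‖`, `‖u × X‖ ≤ ‖X‖` (Pythagoras / Lagrange with `‖u‖ = 1`), while
`|cos θ − 1| ≤ θ²/2` (`Real.one_sub_sq_div_two_le_cos`) and `|sin θ − θ| ≤ θ³/6`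
(`Real.abs_sub_sin_le`); the triangle inequality finishes (`θ³/6 ≤ θ³/4`).
-/

noncomputable section

namespace Summit.AtomisticToContinuum.Crystallization.Theorems

open scoped RealInnerProductSpace
open Literature.Analysis.FluidPDE Literature.Analysis.FluidPDE.Tao2016

/-- `|cos θ − 1| ≤ θ² / 2`. -/
private theorem abs_cos_sub_one_le (θ : ℝ) : |Real.cos θ - 1| ≤ θ ^ 2 / 2 := by
  rw [abs_le]
  refine ⟨by linarith [Real.one_sub_sq_div_two_le_cos (x := θ)], ?_⟩
  linarith [Real.cos_le_one θ, sq_nonneg θ]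

/-- `|sin θ − θ| ≤ θ³ / 6` for `θ ≥ 0`. -/
private theorem abs_sin_sub_le {θ : ℝ} (hθ : 0 ≤ θ) : |Real.sin θ - θ| ≤ θ ^ 3 / 6 := by
  rw [abs_sub_comm]
  simpa [abs_of_nonneg hθ] using Real.abs_sub_sin_le θ

/-- For a unit vector `u`: `‖X − ⟪X, u⟫ u‖ ≤ ‖X‖`. -/
private theorem norm_sub_proj_le {u : EuclideanSpace ℝ (Fin 3)} (hu : ‖u‖ = 1)
    (X : EuclideanSpace ℝ (Fin 3)) : ‖X - ⟪X, u⟫ • u‖ ≤ ‖X‖ := by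
  have h : ‖X - ⟪X, u⟫ • u‖ ^ 2 = ‖X‖ ^ 2 - ⟪X, u⟫ ^ 2 := by
    rw [norm_sub_sq_real, real_inner_smul_right, norm_smul, Real.norm_eq_abs, hu, mul_one, sq_abs]
    ring
  have h2 : ‖X - ⟪X, u⟫ • u‖ ^ 2 ≤ ‖X‖ ^ 2 := by rw [h]; linarith [sq_nonneg ⟪X, u⟫]
  exact (sq_le_sq₀ (norm_nonneg _) (norm_nonneg _)).1 h2

/-- For a unit vector `u`: `‖u × X‖ ≤ ‖X‖`. -/
private theorem norm_cross_unit_le {u : EuclideanSpace ℝ (Fin 3)} (hu : ‖u‖ = 1)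
    (X : EuclideanSpace ℝ (Fin 3)) : ‖cross u X‖ ≤ ‖X‖ := by
  have h2 : ‖cross u X‖ ^ 2 ≤ ‖X‖ ^ 2 := by
    rw [norm_cross_sq, hu]; linarith [sq_nonneg ⟪u, X⟫]
  exact (sq_le_sq₀ (norm_nonneg _) (norm_nonneg _)).1 h2

/-- **Small rotations (Rodrigues remainder).** For every `ω ∈ ℝ³` there is a linear isometry `S`
of `ℝ³` (the rotation by the angle `‖ω‖` about `ω`) with
`‖S X − X − ω × X‖ ≤ (‖ω‖²/2 + ‖ω‖³/4) ‖X‖` for all `X`. -/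
theorem stub_smallRot (ω : EuclideanSpace ℝ (Fin 3)) :
    ∃ S : EuclideanSpace ℝ (Fin 3) ≃ₗᵢ[ℝ] EuclideanSpace ℝ (Fin 3),
      ∀ X, ‖S X - X - Literature.Analysis.FluidPDE.cross ω X‖ ≤ (‖ω‖ ^ 2 / 2 + ‖ω‖ ^ 3 / 4) * ‖X‖ := by
  by_cases hω : ω = 0
  · refine ⟨LinearIsometryEquiv.refl ℝ _, fun X => ?_⟩
    have h0 : cross (0 : EuclideanSpace ℝ (Fin 3)) X = 0 := by
      simpa using cross_smul_left 0 (0 : EuclideanSpace ℝ (Fin 3)) X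
    simp [hω, h0]
  · refine ⟨rodRotEquiv hω ‖ω‖, fun X => ?_⟩
    rw [rodRotEquiv_apply]
    have hθ : 0 ≤ ‖ω‖ := norm_nonneg ω
    have hu1 : ‖udir ω‖ = 1 := norm_udir hω
    have hωu : ω = ‖ω‖ • udir ω := by
      rw [udir, smul_smul, mul_inv_cancel₀ (norm_ne_zero_iff.mpr hω), one_smul]
    have hcr : cross ω X = ‖ω‖ • cross (udir ω) X := by
      conv_lhs => rw [hωu]
      rw [cross_smul_left]
    have key : rodRot ω ‖ω‖ X - X - cross ω X =
        (Real.cos ‖ω‖ - 1) • (X - ⟪X, udir ω⟫ • udir ω) +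
          (Real.sin ‖ω‖ - ‖ω‖) • cross (udir ω) X := by
      rw [hcr, rodRot]
      module
    have hP := norm_sub_proj_le hu1 X
    have hC := norm_cross_unit_le hu1 X
    have hX : 0 ≤ ‖X‖ := norm_nonneg X
    calc ‖rodRot ω ‖ω‖ X - X - cross ω X‖
        = ‖(Real.cos ‖ω‖ - 1) • (X - ⟪X, udir ω⟫ • udir ω) +
            (Real.sin ‖ω‖ - ‖ω‖) • cross (udir ω) X‖ := by rw [key]
      _ ≤ ‖(Real.cos ‖ω‖ - 1) • (X - ⟪X, udir ω⟫ • udir ω)‖ +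
            ‖(Real.sin ‖ω‖ - ‖ω‖) • cross (udir ω) X‖ := norm_add_le _ _
      _ = |Real.cos ‖ω‖ - 1| * ‖X - ⟪X, udir ω⟫ • udir ω‖ +
            |Real.sin ‖ω‖ - ‖ω‖| * ‖cross (udir ω) X‖ := by
          rw [norm_smul, norm_smul, Real.norm_eq_abs, Real.norm_eq_abs]
      _ ≤ ‖ω‖ ^ 2 / 2 * ‖X‖ + ‖ω‖ ^ 3 / 6 * ‖X‖ := by
          gcongr
          · exact abs_cos_sub_one_le ‖ω‖
          · exact abs_sin_sub_le hθ
      _ ≤ (‖ω‖ ^ 2 / 2 + ‖ω‖ ^ 3 / 4) * ‖X‖ := by nlinarith [pow_nonneg hθ 3]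

end Summit.AtomisticToContinuum.Crystallization.Theorems

end
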